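import Literature.Computability.QuantumComplexity.RazTalBlocks
import HarnessLib

/-!
# The Raz–Tal `BQP^O` machine on an XOR-masked window, I: one block with two oracle queries

Variant of `RazTalBlocks.lean` for the algebraic oracle separation `BQP^A ⊄ BPP^Ã`
(Aaronson–Wigderson, Thm. 5.11 (v); tree fact
`Literature.Computability.Complexity.aaronsonWigderson2009_bqp_not_subset_bpp`). Against a machine
querying the multilinear extension of the oracle, the Forrelation window must not be stored in the
clear (file `AlgebraicForrelationFooling.lean`); it is XOR-masked: bit `k` of block `i` of the
level-`n` window is `[rtAddr n i k ++ [0] ∈ O] ⊕ [rtAddr n i k ++ [1] ∈ O]` (`mWindow`). The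
quantum machine reads it by **two phase queries** with the seed wire `o` of the block (which holds
the constant `1` after the classical prefix) appended to the query wires: query (`o = 1`), `NOT o`,
query (`o = 0`), `NOT o`. The accumulated phase is `(−1)^{[q1 ∈ O] ⊕ [q0 ∈ O]}`, i.e. the phase of
the *single* query of the original block for the language `xorLang O = {s | [s0 ∈ O] ≠ [s1 ∈ O]}`,
so the whole amplitude analysis of `RazTalBlocks.lean` applies verbatim with `O` replaced by
`xorLang O`:

* `xorLang`, `queryWiresM = queryWires ++ [o]`, `quantOpsM`, `blockOpsM`, their well-formedness
  and wire bounds, `QlocM`;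
* configurations: `update_cfg_of_le` (updating a wire `≥ n + 2`), `queryOf_cfgM`
  (the queried string is `rtAddr ++ [c o]`), the two-query segment `seg4M_mulVec`:
  `dState c β ↦ dState c (χ̂_{xorLang O} · β)`;
* `compileList_quantOpsM_mulVec`, `QlocM_mulVec_zero`,
  **`sum_ite_normSq_QlocM`**: one run on block `i` accepts with probability exactly
  `blockAcc n (blockWindow (xorLang O) n L i)`, the block of the masked window.

## References

* R. Raz, A. Tal, *Oracle separation of BQP and PH*, J. ACM 69 (2022), §2.2, §6, Claim 8.1,
  App. A [RazTalJACM2022].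
* S. Aaronson, A. Wigderson, *Algebrization: a new barrier in complexity theory*, STOC 2008 (full
  version), Thm. 5.11 (v) [AaronsonWigderson2008].
* M. A. Nielsen, I. L. Chuang, *Quantum Computation and Quantum Information*, CUP 2010, §6.1.1
  (phase kick-back) [NielsenChuang2010].
-/

noncomputable section

namespace Literature.Computability.QuantumComplexity

open _root_.Computability Complexity Cryptography Literature.Probability.RandomGraphs.LowDegree Matrix Finset RevSim

namespace RazTalMachine

/-! ### The XOR of the two copies of a language -/

/-- **The XOR of the two copies**: `s ∈ xorLang O ↔ [s ++ [0] ∈ O] ≠ [s ++ [1] ∈ O]` (the masked bit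
read by the two phase queries). [cite: AaronsonWigderson2008, Thm. 5.11 (v)] -/
def xorLang (A : Language Bool) : Language Bool :=
  {s | A.boolIndicator (s ++ [false]) ≠ A.boolIndicator (s ++ [true])}

/-- The indicator of `xorLang O` is the XOR of the two indicators. [folklore] -/
theorem boolIndicator_xorLang (A : Language Bool) (s : List Bool) :
    (xorLang A).boolIndicator s = xor (A.boolIndicator (s ++ [false])) (A.boolIndicator (s ++ [true])) := by
  by_cases h : A.boolIndicator (s ++ [false]) ≠ A.boolIndicator (s ++ [true])
  · rw [(Set.mem_iff_boolIndicator _ _).1 (show s ∈ xorLang A from h)]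
    revert h
    cases A.boolIndicator (s ++ [false]) <;> cases A.boolIndicator (s ++ [true]) <;> simp
  · rw [(Set.notMem_iff_boolIndicator _ _).1 (show s ∉ xorLang A from fun h' => h h')]
    push Not at h
    rw [h, Bool.xor_self]

/-! ### The block program with two queries -/

section Program

variable (n L : ℕ)

/-- The query wires of the masked block: address, index bits, then the seed wire `o` (the copy
selector). [cite: AaronsonWigderson2008, Thm. 5.11 (v)] -/
def queryWiresM : List ℕ := queryWires n L ++ [oW n]

/-- **The quantum part of a masked block**: as `quantOps`, with the single oracle query replaced by
query (`o = 1`), `NOT o`, query (`o = 0`), `NOT o`. [cite: RazTalJACM2022, §2.2 and §6] [cite: AaronsonWigderson2008, Thm. 5.11 (v)] -/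
def quantOpsM : List (RtOp ℕ) :=
  [RtOp.cl (ClOp.not (tW n)), RtOp.had (tW n)] ++ (List.range (n + 1)).map RtOp.had ++
    [RtOp.oracle (queryWiresM n L) (tW n), RtOp.cl (ClOp.not (oW n)),
      RtOp.oracle (queryWiresM n L) (tW n), RtOp.cl (ClOp.not (oW n))] ++
    (List.range n).map (RtOp.chad (hW n)) ++ [RtOp.had (hW n)]

/-- **The program of masked block `i`.** [cite: RazTalJACM2022, App. A] -/
def blockOpsM (i : ℕ) : List (RtOp ℕ) := (prefixOps n L i).map RtOp.cl ++ quantOpsM n L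

variable {n L}

/-- Membership in the masked query wires. [folklore] -/
theorem mem_queryWiresM {w : ℕ} : w ∈ queryWiresM n L ↔ w < n + 1 ∨ (∃ l, l < L ∧ w = bW n l) ∨ w = oW n := by
  rw [queryWiresM, List.mem_append, List.mem_singleton, mem_queryWires, or_assoc]

/-- The masked query wires and the target are pairwise distinct. [folklore] -/
theorem nodup_queryWiresM_target : (queryWiresM n L ++ [tW n]).Nodup := by
  have h := nodup_queryWires_target (n := n) (L := L)
  rw [List.nodup_append] at h ⊢
  obtain ⟨hq, -, hqt⟩ := h
  refine ⟨?_, List.nodup_singleton _, ?_⟩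
  · rw [queryWiresM, List.nodup_append]
    refine ⟨hq, List.nodup_singleton _, ?_⟩
    intro a ha b hb
    rw [List.mem_singleton] at hb
    subst hb
    rcases mem_queryWires.1 ha with h | ⟨l, -, rfl⟩
    · unfold oW; omega
    · unfold bW oW; omega
  · intro a ha b hb
    rw [List.mem_singleton] at hb
    subst hb
    rcases mem_queryWiresM.1 ha with h | ⟨l, -, rfl⟩ | rfl
    · unfold tW; omega
    · unfold bW tW; omega
    · unfold oW tW; omega

/-- The masked quantum part is well formed. [folklore] -/
theorem quantOpsM_wf : ∀ op ∈ quantOpsM n L, op.WF := by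
  intro op hop
  simp only [quantOpsM, List.mem_append, List.mem_cons, List.mem_map, List.mem_range, List.not_mem_nil, or_false] at hop
  rcases hop with ((((rfl | rfl) | ⟨l, -, rfl⟩) | (rfl | rfl | rfl | rfl)) | ⟨l, hl, rfl⟩) | rfl
  · trivial
  · trivial
  · trivial
  · exact nodup_queryWiresM_target
  · trivial
  · exact nodup_queryWiresM_target
  · trivial
  · change hW n ≠ l; unfold hW; omega
  · trivial

/-- The wires of the masked quantum part: address, target, seed, index bits. [folklore] -/
theorem quantOpsM_wires {op : RtOp ℕ} (hop : op ∈ quantOpsM n L) {w : ℕ} (hw : w ∈ op.wires) :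
    w ≤ n + 2 ∨ ∃ l, l < L ∧ w = bW n l := by
  simp only [quantOpsM, List.mem_append, List.mem_cons, List.mem_map, List.mem_range, List.not_mem_nil, or_false] at hop
  have horacle : w ∈ (RtOp.oracle (queryWiresM n L) (tW n)).wires → w ≤ n + 2 ∨ ∃ l, l < L ∧ w = bW n l := by
    intro hw
    simp only [RtOp.wires, List.mem_append, List.mem_singleton] at hw
    rcases hw with hw | hw
    · rcases mem_queryWiresM.1 hw with h | h | h
      · exact Or.inl (by omega)
      · exact Or.inr h
      · rw [h]; exact Or.inl (by unfold oW; omega)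
    · rw [hw]; exact Or.inl (by unfold tW; omega)
  have hnot : w ∈ (RtOp.cl (ClOp.not (oW n)) : RtOp ℕ).wires → w ≤ n + 2 ∨ ∃ l, l < L ∧ w = bW n l := by
    intro hw
    simp only [RtOp.wires, mem_wiresOf, ClOp.target, ClOp.controls, List.not_mem_nil, or_false] at hw
    rw [hw]; exact Or.inl (by unfold oW; omega)
  rcases hop with ((((rfl | rfl) | ⟨l, hl, rfl⟩) | (rfl | rfl | rfl | rfl)) | ⟨l, hl, rfl⟩) | rfl
  · simp only [RtOp.wires, mem_wiresOf, ClOp.target, ClOp.controls, List.not_mem_nil, or_false] at hw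
    rw [hw]; exact Or.inl (by unfold tW; omega)
  · simp only [RtOp.wires, List.mem_singleton] at hw
    rw [hw]; exact Or.inl (by unfold tW; omega)
  · simp only [RtOp.wires, List.mem_singleton] at hw
    rw [hw]; exact Or.inl (by omega)
  · exact horacle hw
  · exact hnot hw
  · exact horacle hw
  · exact hnot hw
  · simp only [RtOp.wires, List.mem_cons, List.not_mem_nil, or_false] at hw
    rcases hw with h | h
    · rw [h]; exact Or.inl (by unfold hW; omega)
    · rw [h]; exact Or.inl (by omega)
  · simp only [RtOp.wires, List.mem_singleton] at hw
    rw [hw]; exact Or.inl (by unfold hW; omega)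

/-- The masked block program is well formed. [folklore] -/
theorem blockOpsM_wf (i : ℕ) : ∀ op ∈ blockOpsM n L i, op.WF := by
  intro op hop
  simp only [blockOpsM, List.mem_append, List.mem_map] at hop
  rcases hop with ⟨op', hop', rfl⟩ | hop
  · exact prefixOps_wf i op' hop'
  · exact quantOpsM_wf op hop

/-- The wires of the masked block program are below `Bsz`. [folklore] -/
theorem blockOpsM_lt {i : ℕ} (hi : i ≤ rtBlocks n) : ∀ op ∈ blockOpsM n L i, ∀ w ∈ op.wires, w < Bsz n L := by
  intro op hop w hw
  simp only [blockOpsM, List.mem_append, List.mem_map] at hop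
  rcases hop with ⟨op', hop', rfl⟩ | hop
  · exact (prefixOps_wires hi hop' hw).2
  · rcases quantOpsM_wires hop hw with h | ⟨l, hl, rfl⟩
    · unfold Bsz; omega
    · exact bW_lt_Bsz hl

end Program

/-- **The circuit of masked block `i`** on its own `Bsz n L` wires. [cite: RazTalJACM2022, App. A] -/
def QlocM (n L : ℕ) (i : Fin (rtBlocks n)) : QCircuit cliffordT (Bsz n L) :=
  ⟨RtOp.compileList ((blockOpsM n L i).map (RtOp.map (foB n L)))
    (wf_map_finOf_of (Bsz_pos n L) (blockOpsM_wf (n := n) (L := L) i) (blockOpsM_lt (le_of_lt i.isLt)))⟩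

/-! ### The two-query segment on configurations -/

section Quantum

variable {n L : ℕ} (c : QReg (Bsz n L)) (A : Language Bool)

/-- The seed wire as an element of `Fin (Bsz n L)`. [folklore] -/
def fo : Fin (Bsz n L) := foB n L (oW n)

/-- The seed wire is wire `n + 2`. [folklore] -/
@[simp] theorem val_fo : (fo (n := n) (L := L) : ℕ) = n + 2 := val_foB (by unfold oW Bsz; omega)

/-- **Updating a wire beyond the address register and the target commutes with `cfg`.** [folklore] -/
theorem update_cfg_of_le (y : Fin (n + 1) → Bool) (tb : Bool) {p : Fin (Bsz n L)} (hp : n + 2 ≤ (p : ℕ)) (v : Bool) :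
    Function.update (cfg c y tb) p v = cfg (Function.update c p v) y tb := by
  funext p'
  by_cases hpp : p' = p
  · subst hpp
    rw [Function.update_self, cfg_apply_of_le _ _ _ hp, Function.update_self]
  · rw [Function.update_of_ne hpp]
    by_cases hmem : p' ∈ Set.range (aEmb n L)
    · obtain ⟨j, rfl⟩ := hmem
      rw [cfg_apply_aEmb, cfg_apply_aEmb]
    · by_cases hpt : p' = ft n L
      · subst hpt; rw [cfg_apply_ft, cfg_apply_ft]
      · rw [cfg_apply_of_not_mem c _ _ hmem hpt, cfg_apply_of_not_mem _ _ _ hmem hpt, Function.update_of_ne hpp]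

/-- **The query string of the masked oracle gate at a configuration**: the address bits, the index
bits of `c`, then the seed bit of `c`. [cite: NielsenChuang2010, §6.1.1] -/
theorem queryOf_cfgM (y : Fin (n + 1) → Bool) (tb : Bool)
    (h : (((queryWiresM n L).map (foB n L)) ++ [ft n L]).Nodup) :
    queryOf (oracleEmb ((queryWiresM n L).map (foB n L)) (ft n L) h) (cfg c y tb) =
      (List.ofFn y ++ (List.range L).map fun l => c (foB n L (bW n l))) ++ [c (fo (n := n) (L := L))] := by
  unfold queryOf
  have e1 : (List.ofFn fun j : Fin ((queryWiresM n L).map (foB n L)).length =>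
      cfg c y tb (oracleEmb ((queryWiresM n L).map (foB n L)) (ft n L) h j.castSucc)) =
      List.ofFn fun j : Fin ((queryWiresM n L).map (foB n L)).length =>
        cfg c y tb (((queryWiresM n L).map (foB n L))[j.val]) := by
    congr 1
    funext j
    rw [oracleEmb_castSucc]
  have e2 : ((queryWiresM n L).map (foB n L)).map (cfg c y tb) =
      (List.ofFn y ++ (List.range L).map fun l => c (foB n L (bW n l))) ++ [c (fo (n := n) (L := L))] := by
    rw [queryWiresM, queryWires, List.map_append, List.map_append, List.map_append, List.map_append, List.map_map,
      List.map_map, List.map_map]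
    congr 1
    · congr 1
      · rw [map_range_eq_map_finRange, List.ofFn_eq_map]
        refine List.map_congr_left fun j _ => ?_
        exact cfg_apply_aEmb c y tb j
      · refine List.map_congr_left fun l hl => ?_
        rw [List.mem_range] at hl
        simp only [Function.comp_apply]
        exact cfg_apply_of_le c y tb (by rw [val_foB (bW_lt_Bsz hl)]; unfold bW; omega)
    · simp only [List.map_cons, List.map_nil, List.cons.injEq, and_true]
      exact cfg_apply_of_le c y tb (by rw [show foB n L (oW n) = fo from rfl, val_fo])
  rw [e1, List.ofFn_getElem_eq_map, e2]

/-- One masked oracle gate on `Dvec`: the phase `(−1)^{[query ++ [c o] ∈ O]}`. [cite: NielsenChuang2010, §6.1.1 Eq. (6.4)] -/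
theorem oracleM_mulVec_Dvec (y : Fin (n + 1) → Bool) (h : (((queryWiresM n L).map (foB n L)) ++ [ft n L]).Nodup) :
    (QGate.oracle ((queryWiresM n L).map (foB n L)).length (oracleEmb ((queryWiresM n L).map (foB n L)) (ft n L) h) :
        QGate cliffordT (Bsz n L)).toMatrix A *ᵥ Dvec c y =
      sgnC (A.boolIndicator ((List.ofFn y ++ (List.range L).map fun l => c (foB n L (bW n l))) ++ [c fo])) • Dvec c y := by
  have key : ∀ tb, (QGate.oracle ((queryWiresM n L).map (foB n L)).length
      (oracleEmb ((queryWiresM n L).map (foB n L)) (ft n L) h) : QGate cliffordT (Bsz n L)).toMatrix A *ᵥ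
        basisState (cfg c y tb) = basisState (cfg c y
          (tb ^^ A.boolIndicator ((List.ofFn y ++ (List.range L).map fun l => c (foB n L (bW n l))) ++ [c fo]))) := by
    intro tb
    rw [QGate.toMatrix_oracle, placeGate_oracleGate_mulVec_basisState, oracleTarget, oracleEmb_last, queryOf_cfgM,
      cfg_apply_ft, update_cfg_ft]
  rw [Dvec, Matrix.mulVec_sub, key, key]
  cases A.boolIndicator ((List.ofFn y ++ (List.range L).map fun l => c (foB n L (bW n l))) ++ [c fo]) <;> simp [sgnC]

/-- One masked oracle gate on `dState`. [cite: NielsenChuang2010, §6.1.1 Eq. (6.4)] -/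
theorem oracleM_mulVec_dState (β : (Fin (n + 1) → Bool) → ℂ) (h : (((queryWiresM n L).map (foB n L)) ++ [ft n L]).Nodup) :
    (QGate.oracle ((queryWiresM n L).map (foB n L)).length (oracleEmb ((queryWiresM n L).map (foB n L)) (ft n L) h) :
        QGate cliffordT (Bsz n L)).toMatrix A *ᵥ dState c β =
      dState c (fun y => sgnC (A.boolIndicator ((List.ofFn y ++ (List.range L).map fun l => c (foB n L (bW n l))) ++
        [c fo])) * β y) := by
  unfold dState
  rw [Matrix.mulVec_sum]
  exact Finset.sum_congr rfl fun y _ => by rw [Matrix.mulVec_smul, oracleM_mulVec_Dvec, smul_smul, mul_comm]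

/-- **`NOT` on the seed wire moves configurations**: `dState c β ↦ dState (c[o ↦ ¬ c o]) β`. [cite: NielsenChuang2010, §4.2] -/
theorem notSeed_mulVec_dState (β : (Fin (n + 1) → Bool) → ℂ)
    (hX : ∀ op ∈ [RtOp.cl (ClOp.not (fo (n := n) (L := L)))], op.WF) :
    (⟨RtOp.compileList [RtOp.cl (ClOp.not (fo (n := n) (L := L)))] hX⟩ : QCircuit cliffordT (Bsz n L)).toMatrix A *ᵥ
        dState c β = dState (Function.update c fo (!c fo)) β := by
  have key : ∀ (y : Fin (n + 1) → Bool) (tb : Bool),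
      (⟨RtOp.compileList [RtOp.cl (ClOp.not (fo (n := n) (L := L)))] hX⟩ : QCircuit cliffordT (Bsz n L)).toMatrix A *ᵥ
        basisState (cfg c y tb) = basisState (cfg (Function.update c fo (!c fo)) y tb) := by
    intro y tb
    have h := compileList_map_cl_mulVec_basisState A [ClOp.not (fo (n := n) (L := L))] hX (cfg c y tb)
    refine h.trans ?_
    rw [clEval_cons, clEval_nil, ClOp.eval]
    simp only [ClOp.target, ClOp.guard, Bool.xor_true]
    rw [cfg_apply_of_le c y tb (by rw [val_fo]), update_cfg_of_le c y tb (by rw [val_fo])]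
  unfold dState Dvec
  rw [Matrix.mulVec_sum]
  exact Finset.sum_congr rfl fun y _ => by rw [Matrix.mulVec_smul, Matrix.mulVec_sub, key, key]

/-- One compiled masked oracle query on `dState`. [cite: NielsenChuang2010, §6.1.1 Eq. (6.4)] -/
theorem oracleM1_mulVec (hX : ∀ op ∈ [RtOp.oracle ((queryWiresM n L).map (foB n L)) (ft n L)], op.WF)
    (β : (Fin (n + 1) → Bool) → ℂ) :
    (⟨RtOp.compileList [RtOp.oracle ((queryWiresM n L).map (foB n L)) (ft n L)] hX⟩ : QCircuit cliffordT (Bsz n L)).toMatrix A *ᵥ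
      dState c β = dState c (fun y => sgnC (A.boolIndicator ((List.ofFn y ++ (List.range L).map fun l => c (foB n L (bW n l))) ++
        [c fo])) * β y) := by
  rw [RtOp.compileList_cons, RtOp.compileList, List.append_nil, RtOp.compile, QCircuit.toMatrix_cons,
    QCircuit.toMatrix_nil, Matrix.one_mul, oracleM_mulVec_dState]

/-- `(−1)^{a ⊕ b} = (−1)^a (−1)^b`. [folklore] -/
theorem sgnC_xor (a b : Bool) : sgnC (xor a b) = sgnC a * sgnC b := by
  cases a <;> cases b <;> simp [sgnC]

/-- **The two-query segment**: on a configuration with seed `1`, query–`NOT o`–query–`NOT o` applies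
the phase of `xorLang O` and restores the configuration: `dState c β ↦ dState c (χ̂_{xorLang O} · β)`.
[cite: AaronsonWigderson2008, Thm. 5.11 (v)] [cite: NielsenChuang2010, §6.1.1 Eq. (6.4)] -/
theorem seg4M_mulVec (hseed : c fo = true)
    (hX : ∀ op ∈ [RtOp.oracle ((queryWiresM n L).map (foB n L)) (ft n L)] ++ ([RtOp.cl (ClOp.not (fo (n := n) (L := L)))] ++
      ([RtOp.oracle ((queryWiresM n L).map (foB n L)) (ft n L)] ++ [RtOp.cl (ClOp.not (fo (n := n) (L := L)))])), op.WF)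
    (β : (Fin (n + 1) → Bool) → ℂ) :
    (⟨RtOp.compileList ([RtOp.oracle ((queryWiresM n L).map (foB n L)) (ft n L)] ++ ([RtOp.cl (ClOp.not (fo (n := n) (L := L)))] ++
        ([RtOp.oracle ((queryWiresM n L).map (foB n L)) (ft n L)] ++ [RtOp.cl (ClOp.not (fo (n := n) (L := L)))]))) hX⟩ :
        QCircuit cliffordT (Bsz n L)).toMatrix A *ᵥ dState c β =
      dState c (fun y => sgnC (chi c (xorLang A) y) * β y) := by
  set c' : QReg (Bsz n L) := Function.update c fo false with hc'
  have hc'fo : c' fo = false := by simp [hc']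
  have hcc' : Function.update c fo (!c fo) = c' := by rw [hseed]; rfl
  have hc'c : Function.update c' fo (!c' fo) = c := by
    rw [hc'fo, Bool.not_false, hc', Function.update_idem, ← hseed, Function.update_eq_self]
  have hs' : ∀ y : Fin (n + 1) → Bool, (List.ofFn y ++ (List.range L).map fun l => c' (foB n L (bW n l))) =
      List.ofFn y ++ (List.range L).map fun l => c (foB n L (bW n l)) := by
    intro y
    congr 1
    refine List.map_congr_left fun l hl => ?_
    rw [List.mem_range] at hl
    rw [hc', Function.update_of_ne]
    intro h
    have h1 := congrArg Fin.val h
    rw [val_foB (bW_lt_Bsz hl), val_fo] at h1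
    unfold bW at h1
    omega
  rw [RtOp.compileList_append, RtOp.compileList_append, RtOp.compileList_append, toMatrix_mk_append, toMatrix_mk_append,
    toMatrix_mk_append]
  simp only [Matrix.mul_assoc]
  simp only [← Matrix.mulVec_mulVec]
  rw [oracleM1_mulVec, notSeed_mulVec_dState, hcc', oracleM1_mulVec, notSeed_mulVec_dState, hc'c]
  congr 1
  funext y
  rw [hs' y, hc'fo, hseed, ← mul_assoc, ← sgnC_xor, chi, boolIndicator_xorLang, Bool.xor_comm]

end Quantum

/-! ### Composition of the masked quantum part -/

section Compose

variable {n L : ℕ} (c : QReg (Bsz n L)) (A : Language Bool)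
variable (hc : ∀ p : Fin (Bsz n L), (p : ℕ) < n + 2 → c p = false)
include hc

/-- **The masked quantum part on the prefix state** (seed `1`): the compiled operations map the
basis state `c` to `2^{-(n+2)/2} ∑_y blockAmp_{xorLang O}(y) (|cfg y 0⟩ − |cfg y 1⟩)` — the final
state of the original block for the language `xorLang O`. [cite: RazTalJACM2022, §2.2 and §6] [cite: AaronsonWigderson2008, Thm. 5.11 (v)] -/
theorem compileList_quantOpsM_mulVec (hseed : c fo = true)
    (h : ∀ op ∈ (quantOpsM n L).map (RtOp.map (foB n L)), op.WF) :
    (⟨RtOp.compileList ((quantOpsM n L).map (RtOp.map (foB n L))) h⟩ : QCircuit cliffordT (Bsz n L)).toMatrix A *ᵥ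
        basisState c = invSqrt2 ^ (n + 2) • dState c (blockAmp c (xorLang A)) := by
  have hsplit : (quantOpsM n L).map (RtOp.map (foB n L)) =
      ([RtOp.cl (ClOp.not (ft n L)), RtOp.had (ft n L)] ++ ((List.range (n + 1)).map (foB n L)).map RtOp.had) ++
        (([RtOp.oracle ((queryWiresM n L).map (foB n L)) (ft n L)] ++ ([RtOp.cl (ClOp.not (fo (n := n) (L := L)))] ++
          ([RtOp.oracle ((queryWiresM n L).map (foB n L)) (ft n L)] ++ [RtOp.cl (ClOp.not (fo (n := n) (L := L)))]))) ++
          (((List.range n).map (foB n L)).map (RtOp.chad (fh n L)) ++ [RtOp.had (fh n L)])) := by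
    simp [quantOpsM, RtOp.map, ClOp.map, ft, fh, fo, List.map_map, Function.comp_def]
  rw [RtOp.compileList_congr hsplit h (fun op hop => h op (hsplit ▸ hop)),
    RtOp.compileList_append ([RtOp.cl (ClOp.not (ft n L)), RtOp.had (ft n L)] ++ ((List.range (n + 1)).map (foB n L)).map RtOp.had)
      (([RtOp.oracle ((queryWiresM n L).map (foB n L)) (ft n L)] ++ ([RtOp.cl (ClOp.not (fo (n := n) (L := L)))] ++
          ([RtOp.oracle ((queryWiresM n L).map (foB n L)) (ft n L)] ++ [RtOp.cl (ClOp.not (fo (n := n) (L := L)))]))) ++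
          (((List.range n).map (foB n L)).map (RtOp.chad (fh n L)) ++ [RtOp.had (fh n L)])),
    RtOp.compileList_append [RtOp.cl (ClOp.not (ft n L)), RtOp.had (ft n L)] (((List.range (n + 1)).map (foB n L)).map RtOp.had),
    RtOp.compileList_append ([RtOp.oracle ((queryWiresM n L).map (foB n L)) (ft n L)] ++ ([RtOp.cl (ClOp.not (fo (n := n) (L := L)))] ++
          ([RtOp.oracle ((queryWiresM n L).map (foB n L)) (ft n L)] ++ [RtOp.cl (ClOp.not (fo (n := n) (L := L)))])))
      (((List.range n).map (foB n L)).map (RtOp.chad (fh n L)) ++ [RtOp.had (fh n L)]),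
    RtOp.compileList_append (((List.range n).map (foB n L)).map (RtOp.chad (fh n L))) [RtOp.had (fh n L)]]
  rw [toMatrix_mk_append, toMatrix_mk_append, toMatrix_mk_append, toMatrix_mk_append]
  simp only [Matrix.mul_assoc]
  simp only [← Matrix.mulVec_mulVec]
  rw [seg12_mulVec c A hc, Matrix.mulVec_smul, seg3_mulVec, smul_smul, ← pow_succ', Matrix.mulVec_smul,
    seg4M_mulVec c A hseed, Matrix.mulVec_smul, Matrix.mulVec_smul, seg5_mulVec, seg6_mulVec]
  simp only [mul_one]
  rfl

end Compose

/-! ### The masked block circuit: assembly -/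

section Block

variable {n L : ℕ} (A : Language Bool)

/-- The prefix state has seed `1`. [folklore] -/
theorem cPre_fo (i : ℕ) : cPre n L i (fo (n := n) (L := L)) = true := by
  unfold cPre
  rw [val_fo]
  exact (incInv_prefixOps i).seed

/-- **The final state of masked block `i`**: that of the original block for `xorLang O`. [cite: RazTalJACM2022, §2.2, §6 and App. A] -/
theorem QlocM_mulVec_zero (i : Fin (rtBlocks n)) :
    (QlocM n L i).toMatrix A *ᵥ basisState (fun _ => false) =
      invSqrt2 ^ (n + 2) • dState (cPre n L i) (blockAmp (cPre n L i) (xorLang A)) := by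
  have hsplit : (blockOpsM n L i).map (RtOp.map (foB n L)) =
      ((prefixOps n L i).map (ClOp.map (foB n L))).map RtOp.cl ++ (quantOpsM n L).map (RtOp.map (foB n L)) := by
    simp [blockOpsM, List.map_map, Function.comp_def, RtOp.map]
  unfold QlocM
  rw [RtOp.compileList_congr hsplit _ (fun op hop => (wf_map_finOf_of (Bsz_pos n L) (blockOpsM_wf (n := n) (L := L) i)
      (blockOpsM_lt (le_of_lt i.isLt))) op (hsplit ▸ hop)), RtOp.compileList_append, toMatrix_mk_append,
    ← Matrix.mulVec_mulVec, compileList_map_cl_mulVec_basisState]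
  have hcl : clEval ((prefixOps n L i).map (ClOp.map (foB n L))) (fun _ => false) = cPre n L i := by
    funext p
    rw [foB, clEval_map_finOf_apply (Bsz_pos n L) _ (fun op hop w hw => (prefixOps_wires (le_of_lt i.isLt) hop hw).2)]
    unfold cPre
    congr 1
    funext q
    simp [liftW]
  rw [hcl, compileList_quantOpsM_mulVec (cPre n L i) A (cPre_of_lt i) (cPre_fo i)]

/-- **The acceptance weights of masked block `i`**: the Born weight of `{half selector = 0}` is
`blockAcc n (blockWindow (xorLang O) n L i)` — the `(1 + φ)/2` of the block of the *masked* window —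
and that of `{half selector = 1}` is `1 − blockAcc`. [cite: RazTalJACM2022, §6 and Claim 8.1] [cite: AaronsonAmbainis2018, Prop. 6] -/
theorem sum_ite_normSq_QlocM (i : Fin (rtBlocks n)) (b : Bool) :
    (∑ z : QReg (Bsz n L), if z (fh n L) = b then ‖((QlocM n L i).toMatrix A *ᵥ basisState (fun _ => false)) z‖ ^ 2 else 0) =
      if b then 1 - blockAcc n (blockWindow (xorLang A) n L i) else blockAcc n (blockWindow (xorLang A) n L i) := by
  rw [QlocM_mulVec_zero, sum_ite_normSq_final, cWindow_cPre, blockAcc]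
  cases b
  · simp [sgn]
  · simp [sgn]; ring

/-- **The block of the masked window is the masked window**: for `L = rtIdxBits n`, bit `k` of
`blockWindow (xorLang O) n L i` is `[rtAddr n i k ++ [0] ∈ O] ⊕ [rtAddr n i k ++ [1] ∈ O]`.
[cite: AaronsonWigderson2008, Thm. 5.11 (v)] -/
theorem blockWindow_xorLang (i : Fin (rtBlocks n)) (k : Fin (2 * 2 ^ n)) :
    blockWindow (xorLang A) n (rtIdxBits n) i k =
      xor (A.boolIndicator (rtAddr n i k ++ [false])) (A.boolIndicator (rtAddr n i k ++ [true])) := by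
  rw [blockWindow, boolIndicator_xorLang, rtAddr]

end Block

end RazTalMachine

end Literature.Computability.QuantumComplexity

end
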